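import Literature.Topology.FourManifolds.TrisectionCentralSurfacePaths
import Literature.Topology.FourManifolds.TrisectionFunctorGKCentralSurface
import Literature.Topology.FourManifolds.ReducibleTrisectionNonSeparatingPi1Charts
import HarnessLib

/-!
# The two sides of a separating curve on the central surface of a trisection

Topic `Literature/Topology/FourManifolds`; a proved step on the road to the named fact
`Literature.Topology.FourManifolds.Trisection.isConnectedSum_of_reducing_separating` of
`ReducibleTrisectionSplitting.lean` (Aranda–Zupan, arXiv:2503.04607 §2 p. 6: a trisection with a
SEPARATING reducing curve `δ` is a connected sum `T = T′ # T″`; printed proof Meier–Schirmer–Zupan,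
Proc. AMS 144 (2016), §3 Prop. 3.5 and proof of Prop. 3.9).  **Everything here is proved; no
definitions, no named facts.**

The splitting cuts the central surface `F = ⋂ l, S l` along `δ` into the two compact pieces
`F′°`, `F″°` whose cappings are the new central surfaces (`§ Status of the separating fact`,
steps (P3), (P5), (P6) of `ReducibleTrisectionSplitting.lean`).  This file supplies that first,
purely topological, step in the interface already used for the non-separating companion
(`IsGKTrisection.not_simplyConnectedSpace_of_sideCharts`,
`ReducibleTrisectionNonSeparatingPi1Charts.lean`): FLAT CHARTS of `(F, δ)` — at every point of `δ`
an open partial homeomorphism `e` of the subspace `F` to `ℝ × ℝ` with `δ ∩ e.source = {e₂ = 0}`.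

* `exists_two_components_of_locally_twoSided` — general topology: in a connected, locally
  connected space `Y`, let `δ` be closed and preconnected and *locally two-sided* (every
  `p ∈ δ` has a neighbourhood `W` and two preconnected sets `P₁, P₂ ⊆ Y ∖ δ` covering `W ∖ δ`,
  each accumulating at every point of `W ∩ δ`).  If `Y ∖ δ` is disconnected, then it has EXACTLY
  two components `C₁`, `C₂`: open, connected, disjoint, covering `Y ∖ δ`, with
  `closure Cᵢ = Cᵢ ∪ δ`, and every preconnected subset of `Y ∖ δ` lies in one of them.  (Each
  component is open and accumulates somewhere on `δ`, else it would be clopen; where it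
  accumulates it swallows one of `P₁, P₂`, so the set of points of `δ` it adheres to is open and
  closed in the connected `δ`; at one point `p₀ ∈ δ` every component therefore contains `P₁(p₀)`
  or `P₂(p₀)`, whence at most two components.)
* `IsGKTrisection.exists_two_sides_of_not_isNonSeparating` — for a Gay–Kirby trisection `S` of
  `X`, a curve `δ` on `F` (`Trisection.IsCurve`) which is separating
  (`¬ Trisection.IsNonSeparating S δ`) and flat charts of `(F, δ)`:
  `F ∖ δ = Σ₁ ⊔ Σ₂` with `Σ₁`, `Σ₂` connected, relatively open in `F`, `closure Σᵢ = Σᵢ ∪ δ`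
  (so `δ` is the common frontier of its two sides in `F`), and every preconnected subset of
  `F ∖ δ` inside one side.  The central surface is connected
  (`IsGKTrisection.isConnected_iInter`) and locally path connected
  (`IsGKTrisection.locallyPathConnectedSpace_iInter`); in a flat chart the two half-boxes
  `{±e₂ > 0}` over a ball are the local sides.

What remains differential-topological for the separating fact at this level is the
construction of the flat charts from `Trisection.IsCurve` and the corner charts of
`IsGKTrisection` (shared with the non-separating companion, see the programme in
`ReducibleTrisectionNonSeparatingPi1.lean`); the deep inputs (standard 3-balls in the sectors,
the neck, the re-trisection of the capped sides) are listed in `ReducibleTrisectionSplitting.lean`,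
`§ Status of the separating fact`.

## References

* R. Aranda, A. Zupan, *Manifolds with weakly reducible genus-three trisections are standard*,
  arXiv:2503.04607 (2025), §2 p. 6 (reducing curves; the separating case). [ArandaZupan2025]
* J. Meier, T. Schirmer, A. Zupan, *Classification of trisections and the Generalized Property R
  Conjecture*, Proc. AMS 144 (2016), §3, Prop. 3.5 and proof of Prop. 3.9. [MeierSchirmerZupan2016]
* S. Willard, *General Topology*, Addison–Wesley (1970), 26.15, 27.9 (components of open sets in
  locally connected spaces are open).
-/

noncomputable section

open Set Function Filter Topology Metric
open scoped Manifold ContDiff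

namespace Literature.Topology.FourManifolds

universe u

/-! ### General topology: the complement of a locally two-sided connected closed set -/

section TwoSided

variable {Y : Type*} [TopologicalSpace Y]

/-- **Exactly two sides.**  In a connected, locally connected space let `δ` be a closed
preconnected set which is *locally two-sided*: every `p ∈ δ` has a neighbourhood `W` and
preconnected sets `P₁, P₂ ⊆ δᶜ` with `W ∖ δ ⊆ P₁ ∪ P₂` and `W ∩ δ ⊆ closure Pᵢ`.  If `δᶜ` is not
preconnected, then `δᶜ = C₁ ⊔ C₂` with `C₁`, `C₂` open and connected, `closure Cᵢ = Cᵢ ∪ δ`, and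
every preconnected subset of `δᶜ` lies in `C₁` or in `C₂`. [folklore] -/
theorem exists_two_components_of_locally_twoSided [ConnectedSpace Y] [LocallyConnectedSpace Y]
    {δ : Set Y} (hδ : IsPreconnected δ) (hδc : IsClosed δ)
    (hloc : ∀ p ∈ δ, ∃ W ∈ 𝓝 p, ∃ P₁ P₂ : Set Y, IsPreconnected P₁ ∧ IsPreconnected P₂ ∧
      P₁ ⊆ δᶜ ∧ P₂ ⊆ δᶜ ∧ W \ δ ⊆ P₁ ∪ P₂ ∧ W ∩ δ ⊆ closure P₁ ∧ W ∩ δ ⊆ closure P₂)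
    (hsep : ¬ IsPreconnected δᶜ) :
    ∃ C₁ C₂ : Set Y, IsOpen C₁ ∧ IsOpen C₂ ∧ IsConnected C₁ ∧ IsConnected C₂ ∧
      Disjoint C₁ C₂ ∧ C₁ ∪ C₂ = δᶜ ∧ closure C₁ = C₁ ∪ δ ∧ closure C₂ = C₂ ∪ δ ∧
      ∀ P ⊆ δᶜ, IsPreconnected P → P ⊆ C₁ ∨ P ⊆ C₂ := by
  classical
  -- `δ` is non-empty
  have hδne : δ.Nonempty := by
    by_contra h0
    rw [not_nonempty_iff_eq_empty] at h0
    apply hsep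
    rw [h0, compl_empty]
    exact isPreconnected_univ
  obtain ⟨p₀, hp₀⟩ := hδne
  -- the components of the complement
  set C : Y → Set Y := fun x => connectedComponentIn δᶜ x with hC
  have hCo : ∀ x, IsOpen (C x) := fun x => hδc.isOpen_compl.connectedComponentIn
  have hCsub : ∀ x, C x ⊆ δᶜ := fun x => connectedComponentIn_subset _ _
  have hCpre : ∀ x, IsPreconnected (C x) := fun x => isPreconnected_connectedComponentIn
  have hmemC : ∀ x ∈ δᶜ, x ∈ C x := fun x hx => mem_connectedComponentIn hx
  have hCeq : ∀ x z, z ∈ C x → C x = C z := fun x z hz => connectedComponentIn_eq hz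
  -- a preconnected subset of `δᶜ` meeting `C x` lies in it
  have hPsub : ∀ x, ∀ P : Set Y, IsPreconnected P → P ⊆ δᶜ → (P ∩ C x).Nonempty → P ⊆ C x := by
    rintro x P hP hPδ ⟨z, hzP, hzC⟩
    rw [hCeq x z hzC]
    exact hP.subset_connectedComponentIn hzP hPδ
  have hdisj : ∀ x y, C x ≠ C y → Disjoint (C x) (C y) := fun x y hxy =>
    Set.disjoint_left.2 fun z hzx hzy => hxy ((hCeq x z hzx).trans (hCeq y z hzy).symm)
  -- every component accumulates at some point of `δ` (else it would be clopen)
  have hacc : ∀ x ∈ δᶜ, (closure (C x) ∩ δ).Nonempty := by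
    intro x hx
    by_contra h0
    rw [not_nonempty_iff_eq_empty] at h0
    have h1 : closure (C x) ⊆ δᶜ := fun y hy hyδ =>
      (eq_empty_iff_forall_notMem.1 h0 y) ⟨hy, hyδ⟩
    have h2 : closure (C x) ⊆ C x :=
      (hCpre x).closure.subset_connectedComponentIn (subset_closure (hmemC x hx)) h1
    have h3 : IsClosed (C x) := closure_subset_iff_isClosed.1 h2
    have h4 : C x = univ := IsClopen.eq_univ ⟨h3, hCo x⟩ ⟨x, hmemC x hx⟩
    exact hCsub x (h4 ▸ mem_univ p₀) hp₀
  -- the local step: where a component accumulates on `δ`, it swallows a local side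
  choose! W hW P₁ P₂ hP₁ hP₂ hP₁δ hP₂δ hWP hWcl₁ hWcl₂ using hloc
  have hkey : ∀ x, ∀ p ∈ δ, p ∈ closure (C x) → P₁ p ⊆ C x ∨ P₂ p ⊆ C x := by
    intro x p hp hpcl
    obtain ⟨z, hzW, hzC⟩ : (W p ∩ C x).Nonempty := mem_closure_iff_nhds.1 hpcl (W p) (hW p hp)
    rcases hWP p hp ⟨hzW, hCsub x hzC⟩ with hz1 | hz2
    · exact Or.inl (hPsub x _ (hP₁ p hp) (hP₁δ p hp) ⟨z, hz1, hzC⟩)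
    · exact Or.inr (hPsub x _ (hP₂ p hp) (hP₂δ p hp) ⟨z, hz2, hzC⟩)
  have hWδ : ∀ x, ∀ p ∈ δ, p ∈ closure (C x) → W p ∩ δ ⊆ closure (C x) := by
    intro x p hp hpcl
    rcases hkey x p hp hpcl with h1 | h2
    · exact (hWcl₁ p hp).trans (closure_mono h1)
    · exact (hWcl₂ p hp).trans (closure_mono h2)
  -- hence (connectedness of `δ`) all of `δ` adheres to every component
  have hδcl : ∀ x ∈ δᶜ, δ ⊆ closure (C x) := by
    intro x hx q hq
    by_contra hqcl
    set U : Set Y := (closure (C x))ᶜ with hU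
    set V : Set Y := ⋃ p ∈ δ ∩ closure (C x), interior (W p) with hV
    have hUo : IsOpen U := isClosed_closure.isOpen_compl
    have hVo : IsOpen V := isOpen_biUnion fun _ _ => isOpen_interior
    have hmemV : ∀ p ∈ δ, p ∈ closure (C x) → p ∈ V := fun p hp hpcl =>
      mem_biUnion (show p ∈ δ ∩ closure (C x) from ⟨hp, hpcl⟩)
        (mem_interior_iff_mem_nhds.2 (hW p hp))
    have hδUV : δ ⊆ U ∪ V := by
      intro y hy
      by_cases hyc : y ∈ closure (C x)
      · exact Or.inr (hmemV y hy hyc)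
      · exact Or.inl hyc
    have hVcl : δ ∩ V ⊆ closure (C x) := by
      rintro y ⟨hyδ, hyV⟩
      obtain ⟨p, hp, hyp⟩ := mem_iUnion₂.1 hyV
      exact hWδ x p hp.1 hp.2 ⟨interior_subset hyp, hyδ⟩
    obtain ⟨p₁, hp₁cl, hp₁δ⟩ := hacc x hx
    obtain ⟨y, hyδ, hyU, hyV⟩ :=
      hδ U V hUo hVo hδUV ⟨q, hq, hqcl⟩ ⟨p₁, hp₁δ, hmemV p₁ hp₁δ hp₁cl⟩
    exact hyU (hVcl ⟨hyδ, hyV⟩)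
  -- the dichotomy at `p₀`
  have hdich : ∀ x ∈ δᶜ, P₁ p₀ ⊆ C x ∨ P₂ p₀ ⊆ C x := fun x hx =>
    hkey x p₀ hp₀ (hδcl x hx hp₀)
  have hp₀W : p₀ ∈ W p₀ ∩ δ := ⟨mem_of_mem_nhds (hW p₀ hp₀), hp₀⟩
  have hP₁ne : (P₁ p₀).Nonempty := closure_nonempty_iff.1 ⟨p₀, hWcl₁ p₀ hp₀ hp₀W⟩
  have hP₂ne : (P₂ p₀).Nonempty := closure_nonempty_iff.1 ⟨p₀, hWcl₂ p₀ hp₀ hp₀W⟩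
  -- two different components exist
  have hne2 : ∃ a ∈ δᶜ, ∃ b ∈ δᶜ, C a ≠ C b := by
    by_contra hall
    apply hsep
    rcases (δᶜ : Set Y).eq_empty_or_nonempty with h0 | ⟨a, ha⟩
    · rw [h0]; exact isPreconnected_empty
    · have heq : δᶜ = C a := by
        refine Subset.antisymm (fun b hb => ?_) (hCsub a)
        by_contra hbC
        refine hall ⟨a, ha, b, hb, fun hab => hbC ?_⟩
        rw [hab]
        exact hmemC b hb
      rw [heq]
      exact hCpre a
  obtain ⟨a, ha, b, hb, hab⟩ := hne2
  -- assembly, once the two local sides at `p₀` are distributed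
  have finish : ∀ a ∈ δᶜ, ∀ b ∈ δᶜ, C a ≠ C b → P₁ p₀ ⊆ C a → P₂ p₀ ⊆ C b →
      ∃ C₁ C₂ : Set Y, IsOpen C₁ ∧ IsOpen C₂ ∧ IsConnected C₁ ∧ IsConnected C₂ ∧
        Disjoint C₁ C₂ ∧ C₁ ∪ C₂ = δᶜ ∧ closure C₁ = C₁ ∪ δ ∧ closure C₂ = C₂ ∪ δ ∧
        ∀ P ⊆ δᶜ, IsPreconnected P → P ⊆ C₁ ∨ P ⊆ C₂ := by
    intro a ha b hb hab h1 h2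
    have hd : Disjoint (C a) (C b) := hdisj a b hab
    have hcover : ∀ x ∈ δᶜ, C x = C a ∨ C x = C b := by
      intro x hx
      rcases hdich x hx with hx1 | hx2
      · obtain ⟨z, hz⟩ := hP₁ne
        exact Or.inl ((hCeq x z (hx1 hz)).trans (hCeq a z (h1 hz)).symm)
      · obtain ⟨z, hz⟩ := hP₂ne
        exact Or.inr ((hCeq x z (hx2 hz)).trans (hCeq b z (h2 hz)).symm)
    have hunion : C a ∪ C b = δᶜ := by
      refine Subset.antisymm (union_subset (hCsub a) (hCsub b)) fun x hx => ?_
      rcases hcover x hx with h | h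
      · exact Or.inl (h ▸ hmemC x hx)
      · exact Or.inr (h ▸ hmemC x hx)
    have hclos : ∀ x y, x ∈ δᶜ → Disjoint (C x) (C y) → C x ∪ C y = δᶜ →
        closure (C x) = C x ∪ δ := by
      intro x y hx hdxy hxy
      refine Subset.antisymm (fun z hz => ?_) (union_subset subset_closure (hδcl x hx))
      by_cases hzδ : z ∈ δ
      · exact Or.inr hzδ
      · have hz' : z ∈ C x ∪ C y := by rw [hxy]; exact hzδ
        rcases hz' with h | h
        · exact Or.inl h
        · obtain ⟨w, hwy, hwx⟩ := mem_closure_iff_nhds.1 hz (C y) ((hCo y).mem_nhds h)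
          exact absurd hwy (Set.disjoint_left.1 hdxy hwx)
    refine ⟨C a, C b, hCo a, hCo b, ⟨⟨a, hmemC a ha⟩, hCpre a⟩, ⟨⟨b, hmemC b hb⟩, hCpre b⟩, hd,
      hunion, hclos a b ha hd hunion, hclos b a hb hd.symm (union_comm (C a) _ ▸ hunion),
      fun P hP hPc => ?_⟩
    rcases P.eq_empty_or_nonempty with rfl | ⟨z, hz⟩
    · exact Or.inl (empty_subset _)
    · rcases hcover z (hP hz) with h | h
      · exact Or.inl (h ▸ hPsub z P hPc hP ⟨z, hz, hmemC z (hP hz)⟩)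
      · exact Or.inr (h ▸ hPsub z P hPc hP ⟨z, hz, hmemC z (hP hz)⟩)
  rcases hdich a ha with ha1 | ha2
  · have hb2 : P₂ p₀ ⊆ C b := by
      rcases hdich b hb with hb1 | hb2
      · obtain ⟨z, hz⟩ := hP₁ne
        exact absurd (hb1 hz) (Set.disjoint_left.1 (hdisj a b hab) (ha1 hz))
      · exact hb2
    exact finish a ha b hb hab ha1 hb2
  · have hb1 : P₁ p₀ ⊆ C b := by
      rcases hdich b hb with hb1 | hb2
      · exact hb1
      · obtain ⟨z, hz⟩ := hP₂ne
        exact absurd (hb2 hz) (Set.disjoint_left.1 (hdisj a b hab) (ha2 hz))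
    exact finish b hb a ha (Ne.symm hab) hb1 ha2

end TwoSided

/-! ### The two sides of a separating curve on the central surface -/

section Trisection

variable {X : Type u} [TopologicalSpace X] [T2Space X] [ChartedSpace (EuclideanSpace ℝ (Fin 4)) X]
  {g : ℕ} {k : Fin 3 → ℕ} {S : Fin 3 → Set X}

/-- The open upper half-plane of `ℝ × ℝ` is convex. [folklore] -/
theorem convex_snd_pos : Convex ℝ {v : ℝ × ℝ | 0 < v.2} :=
  (convex_Ioi (0 : ℝ)).linear_preimage (LinearMap.snd ℝ ℝ ℝ)

/-- The open lower half-plane of `ℝ × ℝ` is convex. [folklore] -/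
theorem convex_snd_neg : Convex ℝ {v : ℝ × ℝ | v.2 < 0} :=
  (convex_Iio (0 : ℝ)).linear_preimage (LinearMap.snd ℝ ℝ ℝ)

/-- **Local two-sidedness from a flat chart.**  If `e` is an open partial homeomorphism of a
space `Y` to `ℝ × ℝ` around `p`, `e p = 0`, in which a set `δ` is `{e₂ = 0}`, then near `p` the
complement of `δ` is covered by the two preconnected half-boxes `e⁻¹ (B ∩ {±e₂ > 0})` over a
ball `B ⊆ e.target` about `0`, each of which accumulates at every point of `δ` over `B`.
[folklore] -/
theorem exists_local_sides_of_flatChart {Y : Type*} [TopologicalSpace Y] {δ : Set Y} {p : Y}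
    (e : OpenPartialHomeomorph Y (ℝ × ℝ)) (hpe : p ∈ e.source) (hep : e p = 0)
    (hδe : ∀ y ∈ e.source, y ∈ δ ↔ (e y).2 = 0) :
    ∃ W ∈ 𝓝 p, ∃ P₁ P₂ : Set Y, IsPreconnected P₁ ∧ IsPreconnected P₂ ∧
      P₁ ⊆ δᶜ ∧ P₂ ⊆ δᶜ ∧ W \ δ ⊆ P₁ ∪ P₂ ∧ W ∩ δ ⊆ closure P₁ ∧ W ∩ δ ⊆ closure P₂ := by
  obtain ⟨r, hr, hBt⟩ := Metric.isOpen_iff.1 e.open_target 0 (hep ▸ e.map_source hpe)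
  set B : Set (ℝ × ℝ) := Metric.ball 0 r with hB
  have hBo : IsOpen B := Metric.isOpen_ball
  set W : Set Y := e.source ∩ e ⁻¹' B with hWdef
  set P₁ : Set Y := e.symm '' (B ∩ {v | 0 < v.2}) with hP₁def
  set P₂ : Set Y := e.symm '' (B ∩ {v | v.2 < 0}) with hP₂def
  have hWo : IsOpen W := e.isOpen_inter_preimage hBo
  have hpW : p ∈ W := ⟨hpe, show e p ∈ B by rw [hep]; exact Metric.mem_ball_self hr⟩
  have hsymm_cont : ∀ s ⊆ B, ContinuousOn e.symm s := fun s hs =>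
    e.continuousOn_symm.mono (hs.trans hBt)
  -- the half-boxes miss `δ`
  have hPδ : ∀ (s : Set (ℝ × ℝ)), (∀ v ∈ s, v.2 ≠ 0) → e.symm '' (B ∩ s) ⊆ δᶜ := by
    rintro s hs _ ⟨v, ⟨hvB, hvs⟩, rfl⟩ hδ
    have hsrc : e.symm v ∈ e.source := e.map_target (hBt hvB)
    have h0 : (e (e.symm v)).2 = 0 := (hδe _ hsrc).1 hδ
    rw [e.right_inv (hBt hvB)] at h0
    exact hs v hvs h0
  -- points of `δ` over `B` are limits of each half-box
  have hclos : ∀ (ε : ℝ), (ε = 1 ∨ ε = -1) →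
      W ∩ δ ⊆ closure (e.symm '' (B ∩ {v | 0 < ε * v.2})) := by
    rintro ε hε y ⟨⟨hysrc, hyB⟩, hyδ⟩
    have hv2 : (e y).2 = 0 := (hδe y hysrc).1 hyδ
    have hyv : e.symm (e y) = y := e.left_inv hysrc
    -- the path `t ↦ e.symm (e y + (0, ε t))`, `t → 0⁺`
    have h1 : Tendsto (fun t : ℝ => e y + ((0 : ℝ), ε * t)) (𝓝[>] 0) (𝓝 (e y)) := by
      have hc : Continuous fun t : ℝ => e y + ((0 : ℝ), ε * t) :=
        continuous_const.add (continuous_const.prodMk (continuous_const.mul continuous_id))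
      have := hc.tendsto 0
      simp only [mul_zero, Prod.mk_zero_zero, add_zero] at this
      exact this.mono_left nhdsWithin_le_nhds
    have h2 : Tendsto (fun t : ℝ => e.symm (e y + ((0 : ℝ), ε * t))) (𝓝[>] 0) (𝓝 y) := by
      have := (e.continuousAt_symm (hBt hyB)).tendsto.comp h1
      rwa [hyv] at this
    refine mem_closure_of_tendsto h2 ?_
    have hBev : ∀ᶠ t in 𝓝[>] (0 : ℝ), e y + ((0 : ℝ), ε * t) ∈ B := h1 (hBo.mem_nhds hyB)
    filter_upwards [hBev, self_mem_nhdsWithin] with t htB ht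
    refine ⟨e y + ((0 : ℝ), ε * t), ⟨htB, ?_⟩, rfl⟩
    show 0 < ε * (e y + ((0 : ℝ), ε * t)).2
    have ht' : (0 : ℝ) < t := ht
    rcases hε with h | h <;> simp [h, hv2, ht']
  refine ⟨W, hWo.mem_nhds hpW, P₁, P₂,
    ((convex_ball _ _).inter convex_snd_pos).isPreconnected.image _ (hsymm_cont _ inter_subset_left),
    ((convex_ball _ _).inter convex_snd_neg).isPreconnected.image _ (hsymm_cont _ inter_subset_left),
    hPδ _ (fun v hv => ne_of_gt hv), hPδ _ (fun v hv => ne_of_lt hv), ?_, ?_, ?_⟩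
  · -- `W ∖ δ` is covered by the two half-boxes
    rintro y ⟨⟨hysrc, hyB⟩, hyδ⟩
    have hne : (e y).2 ≠ 0 := fun h0 => hyδ ((hδe y hysrc).2 h0)
    have hyv : e.symm (e y) = y := e.left_inv hysrc
    rcases lt_or_gt_of_ne hne with hlt | hgt
    · exact Or.inr ⟨e y, ⟨hyB, hlt⟩, hyv⟩
    · exact Or.inl ⟨e y, ⟨hyB, hgt⟩, hyv⟩
  · simpa only [one_mul] using hclos 1 (Or.inl rfl)
  · have := hclos (-1) (Or.inr rfl)
    simpa only [neg_mul, one_mul, Left.neg_pos_iff] using this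

/-- **The two sides of a separating curve on the central surface** of a Gay–Kirby trisection,
given flat charts of `(F, δ)`: `F ∖ δ = Σ₁ ⊔ Σ₂` with both sides connected, relatively open in
`F = ⋂ l, S l`, `closure Σᵢ = Σᵢ ∪ δ`, and every preconnected subset of `F ∖ δ` inside one
side.  (The pieces `Σ₁ ∪ δ`, `Σ₂ ∪ δ` are the compact surfaces `Σ′°`, `Σ″°` whose cappings are
the central surfaces of the two summands `T′`, `T″`.)
[cite: ArandaZupan2025, §2 p. 6 (separating reducing curves)]
[cite: MeierSchirmerZupan2016, §3 proof of Proposition 3.9] -/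
theorem IsGKTrisection.exists_two_sides_of_not_isNonSeparating (h : IsGKTrisection X g k S)
    {δ : Set X} (hc : Trisection.IsCurve S δ) (hsep : ¬ Trisection.IsNonSeparating S δ)
    (hchart : ∀ p : ↥(⋂ l, S l), (p : X) ∈ δ →
      ∃ e : OpenPartialHomeomorph ↥(⋂ l, S l) (ℝ × ℝ), p ∈ e.source ∧ e p = 0 ∧
        ∀ y ∈ e.source, (y : X) ∈ δ ↔ (e y).2 = 0) :
    ∃ F₁ F₂ : Set X, F₁ ∪ F₂ = (⋂ l, S l) \ δ ∧ Disjoint F₁ F₂ ∧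
      IsConnected F₁ ∧ IsConnected F₂ ∧
      IsOpen (Subtype.val ⁻¹' F₁ : Set ↥(⋂ l, S l)) ∧
      IsOpen (Subtype.val ⁻¹' F₂ : Set ↥(⋂ l, S l)) ∧
      closure F₁ = F₁ ∪ δ ∧ closure F₂ = F₂ ∪ δ ∧
      ∀ P ⊆ (⋂ l, S l) \ δ, IsPreconnected P → P ⊆ F₁ ∨ P ⊆ F₂ := by
  classical
  haveI : LocallyPathConnectedSpace ↥(⋂ l, S l) := h.locallyPathConnectedSpace_iInter
  haveI : ConnectedSpace ↥(⋂ l, S l) := isConnected_iff_connectedSpace.1 h.isConnected_iInter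
  have hFc : IsClosed (⋂ l, S l) := h.isCompact_iInter.isClosed
  have hδF : δ ⊆ ⋂ l, S l := hc.1
  -- the trace of `δ` on the subspace `F`
  set δF : Set ↥(⋂ l, S l) := Subtype.val ⁻¹' δ with hδFdef
  have himage : Subtype.val '' δF = δ := by
    ext y
    simp only [hδFdef, mem_image, mem_preimage]
    exact ⟨fun ⟨z, hz, hzy⟩ => hzy ▸ hz, fun hy => ⟨⟨y, hδF hy⟩, hy, rfl⟩⟩
  have hcimage : Subtype.val '' δFᶜ = (⋂ l, S l) \ δ := by
    ext y
    simp only [hδFdef, mem_image, mem_compl_iff, mem_preimage, Set.mem_sdiff]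
    exact ⟨fun ⟨z, hz, hzy⟩ => hzy ▸ ⟨z.2, hz⟩, fun ⟨hyF, hyδ⟩ => ⟨⟨y, hyF⟩, hyδ, rfl⟩⟩
  have hδFconn : IsPreconnected δF := by
    rw [← Topology.IsInducing.subtypeVal.isPreconnected_image, himage]
    exact hc.isConnected.isPreconnected
  have hδFc : IsClosed δF := hc.isClosed.preimage continuous_subtype_val
  -- local two-sidedness, from the flat charts
  have hloc : ∀ p ∈ δF, ∃ W ∈ 𝓝 p, ∃ P₁ P₂ : Set ↥(⋂ l, S l), IsPreconnected P₁ ∧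
      IsPreconnected P₂ ∧ P₁ ⊆ δFᶜ ∧ P₂ ⊆ δFᶜ ∧ W \ δF ⊆ P₁ ∪ P₂ ∧ W ∩ δF ⊆ closure P₁ ∧
      W ∩ δF ⊆ closure P₂ := by
    intro p hp
    obtain ⟨e, hpe, hep, hδe⟩ := hchart p hp
    exact exists_local_sides_of_flatChart e hpe hep hδe
  -- `F ∖ δ` is non-empty (a local side is), hence not preconnected
  have hsep' : ¬ IsPreconnected δFᶜ := by
    intro hpre
    apply hsep
    refine ⟨?_, ?_⟩
    · obtain ⟨p₀, hp₀⟩ := hc.nonempty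
      obtain ⟨W, hW, P₁, -, -, -, hP₁δ, -, -, hWcl, -⟩ := hloc ⟨p₀, hδF hp₀⟩ hp₀
      obtain ⟨z, hz⟩ : P₁.Nonempty :=
        closure_nonempty_iff.1 ⟨_, hWcl ⟨mem_of_mem_nhds hW, hp₀⟩⟩
      exact ⟨z, z.2, hP₁δ hz⟩
    · show IsPreconnected ((⋂ l, S l) \ δ)
      rw [← hcimage]
      exact Topology.IsInducing.subtypeVal.isPreconnected_image.2 hpre
  obtain ⟨C₁, C₂, hC₁o, hC₂o, hC₁c, hC₂c, hdisj, hunion, hcl₁, hcl₂, hmax⟩ :=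
    exists_two_components_of_locally_twoSided hδFconn hδFc hloc hsep'
  have hcE := hFc.isClosedEmbedding_subtypeVal
  refine ⟨Subtype.val '' C₁, Subtype.val '' C₂, ?_, ?_,
    hC₁c.image _ continuous_subtype_val.continuousOn,
    hC₂c.image _ continuous_subtype_val.continuousOn, ?_, ?_, ?_, ?_, ?_⟩
  · rw [← image_union, hunion, hcimage]
  · exact (Set.disjoint_image_iff Subtype.val_injective).2 hdisj
  · rw [Subtype.val_injective.preimage_image]; exact hC₁o
  · rw [Subtype.val_injective.preimage_image]; exact hC₂o
  · rw [hcE.closure_image_eq, hcl₁, image_union, himage]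
  · rw [hcE.closure_image_eq, hcl₂, image_union, himage]
  · intro P hP hPc
    have hPF : P ⊆ ⋂ l, S l := fun y hy => (hP hy).1
    have hPim : Subtype.val '' (Subtype.val ⁻¹' P : Set ↥(⋂ l, S l)) = P := by
      rw [Subtype.image_preimage_coe, inter_eq_right.2 hPF]
    have hPc' : IsPreconnected (Subtype.val ⁻¹' P : Set ↥(⋂ l, S l)) := by
      rw [← Topology.IsInducing.subtypeVal.isPreconnected_image, hPim]
      exact hPc
    have hPδ : (Subtype.val ⁻¹' P : Set ↥(⋂ l, S l)) ⊆ δFᶜ := fun z hz => (hP hz).2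
    rcases hmax _ hPδ hPc' with h1 | h2
    · left; rw [← hPim]; exact image_mono h1
    · right; rw [← hPim]; exact image_mono h2

end Trisection

end Literature.Topology.FourManifolds

end
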